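import Literature.MathematicalPhysics.QuantumFieldTheory.SpeciesTimeReflection
import Literature.MathematicalPhysics.QuantumLattice.GrassmannIntegralSubstitution
import Literature.MathematicalPhysics.QuantumLattice.GrassmannIntegralBerezinProofs
import Literature.MathematicalPhysics.QuantumLattice.GrassmannIntegralProofs
import Literature.MathematicalPhysics.QuantumLattice.GrassmannParity
import Literature.MathematicalPhysics.QuantumLattice.GrassmannGaussianChargeRule
import HarnessLib

/-!
# Towards `WilsonQCDSiteReflectionPositivityAP`: the time reflection on the torus quark algebra

Theorem-only companion of `QCDTimeReflection` (proofs for the named fact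
`WilsonQCDSiteReflectionPositivityAP`, Lüscher 1977 / Montvay–Münster §4.2.3). This file carries
out the first, purely covariant part of the Osterwalder–Seiler/Lüscher argument on the torus of
side `L`:

* `torusThetaLin`, `torusTheta` — the antilinear, order-reversing site reflection `Θ_T` of
  Montvay–Münster (4.99) on the TORUS quark Grassmann algebra `FermiAlg Nf L` (the box version is
  `fermiTheta` of `QCDTimeReflection`): `Θψ_{x,t} = ψ̄_{x,−t}γ₀`, `Θψ̄_{x,t} = γ₀ψ_{x,−t}`; it is
  antimultiplicative (`torusTheta_mul`) and an involution (`torusTheta_torusTheta`, from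
  `γ₀γ₀† = 1`).
* `osAdjoint_onTorus` — placing the reflected observable on the torus is reflecting the placed
  observable read on the reflected gauge field: `(ΘA).onTorus L v U = Θ_T (A.onTorus L (θv) (Θ'U))`
  (`Θ' = GaugeConfig.negReflect`).
* `torusTheta_fermiBoltzmannAP` — reflection symmetry of the antiperiodic Wilson quark action on the
  ODD torus (Montvay–Münster (4.95)/(4.106): `ΘS = S ∘ Θ'`): `Θ_T e^{−ψ̄D^{AP}(U)ψ} = e^{−ψ̄D^{AP}(Θ'U)ψ}`.
* `fermiIntegral_torusTheta` — `∫dψ̄dψ (Θ_T a) = c · conj (∫dψ̄dψ a)` with the constant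
  `c = thetaBerezinConst` (reversal sign `(-1)^{n(n-1)/2}` of the top monomial, `berezin_reverse`,
  times the fermionic Jacobian `det T` of the generator substitution, `berezin_map`).
* `torusTheta_quadratic`, `thetaMatrix` — `Θ_T (ψ̄Aψ) = ψ̄A^Θψ` with
  `A^Θ_{pq} = ∑ (γ₀)_{σ_pβ} conj A_{(θq)_α(θp)_β} (γ₀)_{ασ_q}` (Montvay–Münster (4.92));
  `gamma_conj_wBlock` — `γ₀ [W(U)_{(θy,b),(θx,a)}]ᴴ γ₀ = W(Θ'U)_{(x,a),(y,b)}` for the spin blocks of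
  the antiperiodic Wilson–Dirac matrix on the odd torus (the antiperiodic layer is reflection
  symmetric, `apLinkSign_negReflect_shift`).
* `WilsonQCDSiteReflectionPositivityAP_im` — consequently the Osterwalder–Schrader pairing
  `⟨A · ΘA⟩_AP` of the fact is REAL (the `im = 0` half of `WilsonQCDSiteReflectionPositivityAP`,
  for every `β`, `S`, all masses and every observable), by `Θ'`-invariance of Wilson's measure
  (`integral_comp_negReflect_eq`).

The positivity half (`0 ≤ re`, Montvay–Münster (4.100)–(4.111) with the gauge field and the
antiperiodic link layer) is not in this file.

References: I. Montvay, G. Münster, *Quantum Fields on a Lattice* (CUP 1994) §4.2.3 (4.90)–(4.111),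
§4.2.4 (4.112)–(4.115); M. Lüscher, Commun. Math. Phys. 54 (1977) 283; K. Osterwalder, E. Seiler,
Ann. Phys. 110 (1978) 440, §2. All statements here are proved.
-/

open MeasureTheory
open scoped Matrix ComplexConjugate
open Literature.Probability Literature.Probability.LatticeModels Literature.MathematicalPhysics.QuantumLattice

noncomputable section

namespace Literature.MathematicalPhysics.QuantumFieldTheory

/-! ### The reflection `Θ_T` on the torus quark Grassmann algebra -/

section TorusTheta

local notation "𝔾" => Matrix.specialUnitaryGroup (Fin 3) ℂ

variable {Nf L : ℕ} [NeZero L]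

/-- `γ₀ γ₀† = 1` entrywise: `∑_α (γ₀)_{σα} conj (γ₀)_{δα} = δ_{σδ}`. [folklore] -/
theorem sum_euclideanGamma_zero_mul_star (σ δ : Fin 4) :
    ∑ α, euclideanGamma 0 σ α * star (euclideanGamma 0 δ α) = if σ = δ then 1 else 0 := by
  fin_cases σ <;> fin_cases δ <;> simp [euclideanGamma_zero, Fin.sum_univ_four]

/-- `γ₀ᵀ γ̄₀ = 1` entrywise: `∑_α (γ₀)_{ασ} conj (γ₀)_{αδ} = δ_{σδ}`. [folklore] -/
theorem sum_euclideanGamma_zero_mul_star' (σ δ : Fin 4) :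
    ∑ α, euclideanGamma 0 α σ * star (euclideanGamma 0 α δ) = if σ = δ then 1 else 0 := by
  fin_cases σ <;> fin_cases δ <;> simp [euclideanGamma_zero, Fin.sum_univ_four]

/-- **The site reflection on torus quark generators** (Montvay–Münster (4.99) with the time
direction `0` and `γ₀ = euclideanGamma 0`, torus sites reflected by `Site.negReflect`): the linear
map of generator-coefficient vectors inducing `ψ_{f,x,a,α} ↦ ∑_β ψ̄_{f,θx,a,β} (γ₀)_{βα}` and
`ψ̄_{f,x,a,α} ↦ ∑_β (γ₀)_{αβ} ψ_{f,θx,a,β}` — the torus twin of `fermiThetaLin`. [cite: MontvayMunster1994, §4.2.3 (4.99)] -/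
def torusThetaLin :
    ((FermiIdx Nf L ⊕ₗ FermiIdx Nf L) → ℂ) →ₗ[ℂ] ((FermiIdx Nf L ⊕ₗ FermiIdx Nf L) → ℂ) :=
  LinearMap.pi fun w =>
    match ofLex w with
    | Sum.inl i =>
        let v := quarkEquiv.symm i
        ∑ α : Fin 4, (euclideanGamma 0 v.2.2.2 α) •
          LinearMap.proj (toLex (Sum.inr (quarkEquiv (v.1, (Site.negReflect v.2.1, v.2.2.1, α)))))
    | Sum.inr i =>
        let v := quarkEquiv.symm i
        ∑ α : Fin 4, (euclideanGamma 0 α v.2.2.2) •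
          LinearMap.proj (toLex (Sum.inl (quarkEquiv (v.1, (Site.negReflect v.2.1, v.2.2.1, α)))))

/-- The `ψ̄`-coordinates of `T c`: `(T c)_{ψ̄,(f,x,a,σ)} = ∑_α (γ₀)_{σα} c_{ψ,(f,θx,a,α)}`. [folklore] -/
theorem torusThetaLin_apply_inl (c : (FermiIdx Nf L ⊕ₗ FermiIdx Nf L) → ℂ) (v : QuarkVar Nf L) :
    torusThetaLin c (toLex (Sum.inl (quarkEquiv v))) =
      ∑ α : Fin 4, euclideanGamma 0 v.2.2.2 α *
        c (toLex (Sum.inr (quarkEquiv (v.1, (Site.negReflect v.2.1, v.2.2.1, α))))) := by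
  simp only [torusThetaLin, LinearMap.pi_apply, ofLex_toLex, Equiv.symm_apply_apply,
    LinearMap.coe_sum, Finset.sum_apply, LinearMap.smul_apply, LinearMap.proj_apply, smul_eq_mul]

/-- The `ψ`-coordinates of `T c`: `(T c)_{ψ,(f,x,a,σ)} = ∑_α (γ₀)_{ασ} c_{ψ̄,(f,θx,a,α)}`. [folklore] -/
theorem torusThetaLin_apply_inr (c : (FermiIdx Nf L ⊕ₗ FermiIdx Nf L) → ℂ) (v : QuarkVar Nf L) :
    torusThetaLin c (toLex (Sum.inr (quarkEquiv v))) =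
      ∑ α : Fin 4, euclideanGamma 0 α v.2.2.2 *
        c (toLex (Sum.inl (quarkEquiv (v.1, (Site.negReflect v.2.1, v.2.2.1, α))))) := by
  simp only [torusThetaLin, LinearMap.pi_apply, ofLex_toLex, Equiv.symm_apply_apply,
    LinearMap.coe_sum, Finset.sum_apply, LinearMap.smul_apply, LinearMap.proj_apply, smul_eq_mul]

/-- `T ∘ conj ∘ T ∘ conj = id`: the generator substitution is an involution up to conjugation of
coefficients (`γ₀γ₀† = 1`). [folklore] -/
theorem torusThetaLin_conjLin_torusThetaLin (c : (FermiIdx Nf L ⊕ₗ FermiIdx Nf L) → ℂ) :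
    torusThetaLin (conjLin (torusThetaLin (Nf := Nf) (L := L)) c) = c := by
  funext w
  obtain ⟨x, rfl⟩ : ∃ x, toLex x = w := ⟨ofLex w, rfl⟩
  rcases x with i | i
  · obtain ⟨v, rfl⟩ := quarkEquiv.surjective i
    rw [torusThetaLin_apply_inl]
    simp only [conjLin_apply, Pi.star_apply, torusThetaLin_apply_inr, star_sum, star_mul',
      star_star, WilsonSiteRP.negReflect_negReflect, Finset.mul_sum]
    rw [Finset.sum_comm]
    simp_rw [← mul_assoc, ← Finset.sum_mul, sum_euclideanGamma_zero_mul_star, ite_mul, one_mul,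
      zero_mul, Finset.sum_ite_eq, Finset.mem_univ, if_true]
  · obtain ⟨v, rfl⟩ := quarkEquiv.surjective i
    rw [torusThetaLin_apply_inr]
    simp only [conjLin_apply, Pi.star_apply, torusThetaLin_apply_inl, star_sum, star_mul',
      star_star, WilsonSiteRP.negReflect_negReflect, Finset.mul_sum]
    rw [Finset.sum_comm]
    simp_rw [← mul_assoc, ← Finset.sum_mul, sum_euclideanGamma_zero_mul_star', ite_mul, one_mul,
      zero_mul, Finset.sum_ite_eq, Finset.mem_univ, if_true]

/-- **The Osterwalder–Seiler/Lüscher time reflection `Θ_T` on the torus quark Grassmann algebra**: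
`Θ_T = rev ∘ Λ(T) ∘ conj` — conjugate the coefficients, substitute the generators by
`torusThetaLin` (4.99), reverse the order of every monomial; a `conj`-semilinear map (the torus
twin of `fermiTheta`). [cite: MontvayMunster1994, §4.2.3 (4.91) and (4.99)] -/
def torusTheta : FermiAlg Nf L →ₗ⋆[ℂ] FermiAlg Nf L :=
  ((CliffordAlgebra.reverse : FermiAlg Nf L →ₗ[ℂ] FermiAlg Nf L).comp
      (ExteriorAlgebra.map (torusThetaLin (Nf := Nf) (L := L))).toLinearMap).comp
    grassmannConjₛₗ

/-- `Θ_T a = rev (Λ(T) (conj a))`. [folklore] -/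
theorem torusTheta_apply (a : FermiAlg Nf L) :
    torusTheta a =
      CliffordAlgebra.reverse (ExteriorAlgebra.map (torusThetaLin (Nf := Nf) (L := L))
        (grassmannConj a)) := rfl

/-- `Θ_T` reverses products: `Θ_T(ab) = Θ_T(b) Θ_T(a)`. [cite: MontvayMunster1994, §4.2.3 (4.92)] -/
theorem torusTheta_mul (a b : FermiAlg Nf L) :
    torusTheta (a * b) = torusTheta b * torusTheta a := by
  simp only [torusTheta_apply, map_mul, CliffordAlgebra.reverse.map_mul]

/-- `Θ_T 1 = 1`. [folklore] -/
@[simp] theorem torusTheta_one : torusTheta (1 : FermiAlg Nf L) = 1 := by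
  simp only [torusTheta_apply, map_one, CliffordAlgebra.reverse.map_one]

/-- `Θ_T` on scalars is complex conjugation. [folklore] -/
@[simp] theorem torusTheta_algebraMap (c : ℂ) :
    torusTheta (algebraMap ℂ (FermiAlg Nf L) c) = algebraMap ℂ (FermiAlg Nf L) (starRingEnd ℂ c) := by
  simp only [torusTheta_apply, grassmannConj_algebraMap, AlgHom.commutes,
    CliffordAlgebra.reverse.commutes]

/-- `Θ_T` on a degree-one element: `Θ_T θ(v) = θ(T v̄)`. [folklore] -/
theorem torusTheta_ι (v : (FermiIdx Nf L ⊕ₗ FermiIdx Nf L) → ℂ) :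
    torusTheta (ExteriorAlgebra.ι ℂ v) =
      ExteriorAlgebra.ι ℂ (torusThetaLin (Nf := Nf) (L := L) (star v)) := by
  simp only [torusTheta_apply, grassmannConj_ι, ExteriorAlgebra.map_apply_ι, CliffordAlgebra.reverse_ι]

/-- `Θ_T` of a power is the power of `Θ_T`. [folklore] -/
theorem torusTheta_pow (a : FermiAlg Nf L) (n : ℕ) : torusTheta (a ^ n) = torusTheta a ^ n := by
  induction n with
  | zero => simp
  | succ n ih => rw [pow_succ, torusTheta_mul, ih, ← pow_succ']

/-- **`Θ_T` is an involution**: `Θ_T (Θ_T a) = a` (antilinearity twice, reversal twice, and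
`T T̄ = 1` by `γ₀γ₀† = 1`). [cite: MontvayMunster1994, §4.2.3 (4.99)] -/
@[simp] theorem torusTheta_torusTheta (a : FermiAlg Nf L) : torusTheta (torusTheta a) = a := by
  induction a using ExteriorAlgebra.induction with
  | algebraMap c => rw [torusTheta_algebraMap, torusTheta_algebraMap, starRingEnd_self_apply]
  | ι v =>
    rw [torusTheta_ι, torusTheta_ι]
    congr 1
    have h := torusThetaLin_conjLin_torusThetaLin (Nf := Nf) (L := L) v
    rwa [conjLin_apply] at h
  | mul a b ha hb => rw [torusTheta_mul, torusTheta_mul, ha, hb]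
  | add a b ha hb => rw [map_add, map_add, ha, hb]

/-- The substitution `T` on the coefficient vector of `ψ_{f,x,a,α}`:
`e_{ψ,(f,x,a,α)} ↦ ∑_β (γ₀)_{βα} e_{ψ̄,(f,θx,a,β)}`. [cite: MontvayMunster1994, §4.2.3 (4.99)] -/
theorem torusThetaLin_single_inr (f : Fin Nf) (x : TorusSite 4 L) (a : Fin 3) (α : Fin 4) :
    torusThetaLin (Nf := Nf) (L := L) (Pi.single (toLex (Sum.inr (quarkEquiv (f, (x, a, α))))) 1) =
      ∑ β : Fin 4, euclideanGamma 0 β α •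
        Pi.single (toLex (Sum.inl (quarkEquiv (Nf := Nf) (L := L) (f, (Site.negReflect x, a, β))))) (1 : ℂ) := by
  funext w
  obtain ⟨y, rfl⟩ : ∃ y, toLex y = w := ⟨ofLex w, rfl⟩
  rcases y with i | i
  · obtain ⟨⟨f', x', a', β'⟩, rfl⟩ := quarkEquiv.surjective i
    rw [torusThetaLin_apply_inl]
    simp only [Finset.sum_apply, Pi.smul_apply, Pi.single_apply, Sum.inr.injEq,
      Sum.inl.injEq, EmbeddingLike.apply_eq_iff_eq, Prod.mk.injEq, smul_eq_mul, mul_ite, mul_one,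
      mul_zero]
    by_cases hf : f' = f
    · by_cases ha : a' = a
      · by_cases hx : Site.negReflect x' = x
        · subst hf ha hx
          simp [Finset.sum_ite_eq']
        · have hx' : ¬ x' = Site.negReflect x := fun h => hx (by rw [h, WilsonSiteRP.negReflect_negReflect])
          simp [hx, hx']
      · simp [ha]
    · simp [hf]
  · obtain ⟨v, rfl⟩ := quarkEquiv.surjective i
    rw [torusThetaLin_apply_inr]
    simp only [Finset.sum_apply, Pi.smul_apply, Pi.single_apply, toLex_inj, reduceCtorEq, if_false,
      mul_zero, Finset.sum_const_zero, smul_eq_mul]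

/-- The substitution `T` on the coefficient vector of `ψ̄_{f,x,a,α}`:
`e_{ψ̄,(f,x,a,α)} ↦ ∑_β (γ₀)_{αβ} e_{ψ,(f,θx,a,β)}`. [cite: MontvayMunster1994, §4.2.3 (4.99)] -/
theorem torusThetaLin_single_inl (f : Fin Nf) (x : TorusSite 4 L) (a : Fin 3) (α : Fin 4) :
    torusThetaLin (Nf := Nf) (L := L) (Pi.single (toLex (Sum.inl (quarkEquiv (f, (x, a, α))))) 1) =
      ∑ β : Fin 4, euclideanGamma 0 α β •
        Pi.single (toLex (Sum.inr (quarkEquiv (Nf := Nf) (L := L) (f, (Site.negReflect x, a, β))))) (1 : ℂ) := by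
  funext w
  obtain ⟨y, rfl⟩ : ∃ y, toLex y = w := ⟨ofLex w, rfl⟩
  rcases y with i | i
  · obtain ⟨v, rfl⟩ := quarkEquiv.surjective i
    rw [torusThetaLin_apply_inl]
    simp only [Finset.sum_apply, Pi.smul_apply, Pi.single_apply, toLex_inj, reduceCtorEq, if_false,
      mul_zero, Finset.sum_const_zero, smul_eq_mul]
  · obtain ⟨⟨f', x', a', β'⟩, rfl⟩ := quarkEquiv.surjective i
    rw [torusThetaLin_apply_inr]
    simp only [Finset.sum_apply, Pi.smul_apply, Pi.single_apply, Sum.inr.injEq,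
      Sum.inl.injEq, EmbeddingLike.apply_eq_iff_eq, Prod.mk.injEq, smul_eq_mul, mul_ite, mul_one,
      mul_zero]
    by_cases hf : f' = f
    · by_cases ha : a' = a
      · by_cases hx : Site.negReflect x' = x
        · subst hf ha hx
          simp [Finset.sum_ite_eq']
        · have hx' : ¬ x' = Site.negReflect x := fun h => hx (by rw [h, WilsonSiteRP.negReflect_negReflect])
          simp [hx, hx']
      · simp [ha]
    · simp [hf]

/-- **`Θψ_{x,t} = ψ̄_{x,−t} γ₀` on the torus**: `Θ_T ψ_{f,x,a,α} = ∑_β (γ₀)_{βα} ψ̄_{f,θx,a,β}`. [cite: MontvayMunster1994, §4.2.3 (4.99)] -/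
theorem torusTheta_q (f : Fin Nf) (x : TorusSite 4 L) (a : Fin 3) (α : Fin 4) :
    torusTheta (q (f, (x, a, α))) =
      ∑ β : Fin 4, euclideanGamma 0 β α • qbar (f, (Site.negReflect x, a, β)) := by
  simp only [q, qbar, psi, psiBar, GrassmannAlgebra.gen, torusTheta_ι, ← Pi.single_star, star_one,
    torusThetaLin_single_inr, map_sum, map_smul]

/-- **`Θψ̄_{x,t} = γ₀ ψ_{x,−t}` on the torus**: `Θ_T ψ̄_{f,x,a,α} = ∑_β (γ₀)_{αβ} ψ_{f,θx,a,β}`. [cite: MontvayMunster1994, §4.2.3 (4.99)] -/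
theorem torusTheta_qbar (f : Fin Nf) (x : TorusSite 4 L) (a : Fin 3) (α : Fin 4) :
    torusTheta (qbar (f, (x, a, α))) =
      ∑ β : Fin 4, euclideanGamma 0 α β • q (f, (Site.negReflect x, a, β)) := by
  simp only [q, qbar, psi, psiBar, GrassmannAlgebra.gen, torusTheta_ι, ← Pi.single_star, star_one,
    torusThetaLin_single_inl, map_sum, map_smul]

end TorusTheta

/-! ### Placing observables on the torus commutes with the reflection -/

section Placing

local notation "𝔾" => Matrix.specialUnitaryGroup (Fin 3) ℂ

variable {Nf R : ℕ}

/-- The site reflection of `ℤ⁴` is additive. [folklore] -/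
theorem siteReflect_add (x y : LatticeModels.Site 4) :
    siteReflect (x + y) = siteReflect x + siteReflect y := by
  funext k
  simp only [siteReflect_apply_ite, Pi.add_apply]
  split_ifs <;> ring

/-- Reduction mod `S` commutes with the site reflection: `proj (θ₀ y) = Θ' (proj y)`. [folklore] -/
theorem proj_siteReflect (S : ℕ) (y : LatticeModels.Site 4) :
    Torus.proj S (siteReflect y) = Site.negReflect (Torus.proj S y) := by
  funext k
  by_cases hk : k = 0
  · subst hk; simp
  · simp [WilsonSiteRP.negReflect_apply_of_ne _ hk, siteReflect_apply_of_ne _ hk]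

variable (Nf R) in
/-- The linear map of generator coefficients placing the boxed quark variables at `v` on the torus
of side `S` (`e_w ↦ e_{toTorusIdx S v w}`; the map `onTorus` applies `ExteriorAlgebra.map` to). [folklore] -/
abbrev placeLin (S : ℕ) [NeZero S] (v : LatticeModels.Site 4) :
    ((BoxFermiIdx Nf R ⊕ₗ BoxFermiIdx Nf R) → ℂ) →ₗ[ℂ] ((FermiIdx Nf S ⊕ₗ FermiIdx Nf S) → ℂ) :=
  Fintype.linearCombination ℂ fun w =>
    Pi.single (QCDLatticeObservable.toTorusIdx (Nf := Nf) (R := R) S v w) (1 : ℂ)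

variable {S : ℕ} [NeZero S]

/-- The placing map on a basis vector. [folklore] -/
theorem placeLin_single (v : LatticeModels.Site 4) (w : BoxFermiIdx Nf R ⊕ₗ BoxFermiIdx Nf R) :
    placeLin Nf R S v (Pi.single w 1) =
      Pi.single (QCDLatticeObservable.toTorusIdx (Nf := Nf) (R := R) S v w) (1 : ℂ) := by
  classical
  rw [placeLin, Fintype.linearCombination_apply_single, one_smul]

/-- The placing map has real (`0/1`) matrix entries: it commutes with conjugation. [folklore] -/
theorem placeLin_star (v : LatticeModels.Site 4) (c : (BoxFermiIdx Nf R ⊕ₗ BoxFermiIdx Nf R) → ℂ) :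
    placeLin Nf R S v (star c) = star (placeLin Nf R S v c) := by
  simp only [placeLin, Fintype.linearCombination_apply, star_sum, Pi.star_apply, star_smul,
    ← Pi.single_star, star_one]

/-- **The placing map intertwines the generator substitutions of `Θ` (box) and `Θ_T` (torus)**:
`P_v ∘ T = T_torus ∘ P_{θ₀v}` on coefficient vectors. [folklore] -/
theorem placeLin_comp_fermiThetaLin (v : LatticeModels.Site 4) :
    placeLin Nf R S v ∘ₗ fermiThetaLin =
      torusThetaLin ∘ₗ placeLin Nf R S (siteReflect v) := by
  classical
  refine (Pi.basisFun ℂ _).ext fun w => ?_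
  obtain ⟨y, rfl⟩ : ∃ y, toLex y = w := ⟨ofLex w, rfl⟩
  rcases y with i | i
  · obtain ⟨⟨f, x, a, α⟩, rfl⟩ := boxQuarkEquiv.surjective i
    rw [Pi.basisFun_apply, LinearMap.comp_apply, LinearMap.comp_apply, fermiThetaLin_single_inl,
      map_sum, placeLin_single]
    simp only [map_smul, placeLin_single, QCDLatticeObservable.toTorusIdx, ofLex_toLex,
      Equiv.symm_apply_apply, torusThetaLin_single_inl, coe_boxSiteReflect]
    rw [← proj_siteReflect, siteReflect_add, siteReflect_siteReflect]
  · obtain ⟨⟨f, x, a, α⟩, rfl⟩ := boxQuarkEquiv.surjective i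
    rw [Pi.basisFun_apply, LinearMap.comp_apply, LinearMap.comp_apply, fermiThetaLin_single_inr,
      map_sum, placeLin_single]
    simp only [map_smul, placeLin_single, QCDLatticeObservable.toTorusIdx, ofLex_toLex,
      Equiv.symm_apply_apply, torusThetaLin_single_inr, coe_boxSiteReflect]
    rw [← proj_siteReflect, siteReflect_add, siteReflect_siteReflect]

/-- **Placing commutes with the reflection at the level of the Grassmann algebras**:
`Λ(P_v) (Θ a) = Θ_T (Λ(P_{θ₀v}) a)`. [folklore] -/
theorem map_placeLin_fermiTheta (v : LatticeModels.Site 4) (a : BoxFermiAlg Nf R) :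
    ExteriorAlgebra.map (placeLin Nf R S v) (fermiTheta a) =
      torusTheta (ExteriorAlgebra.map (placeLin Nf R S (siteReflect v)) a) := by
  induction a using ExteriorAlgebra.induction with
  | algebraMap c => simp only [fermiTheta_algebraMap, AlgHom.commutes, torusTheta_algebraMap]
  | ι u =>
    rw [fermiTheta_ι, ExteriorAlgebra.map_apply_ι, ExteriorAlgebra.map_apply_ι, torusTheta_ι,
      ← placeLin_star]
    exact congrArg (ExteriorAlgebra.ι ℂ) (LinearMap.congr_fun (placeLin_comp_fermiThetaLin v) (star u))
  | mul a b ha hb => rw [fermiTheta_mul, map_mul, map_mul, ha, hb, torusTheta_mul]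
  | add a b ha hb => simp only [map_add, ha, hb]

/-- **`(ΘA).onTorus = Θ_T ∘ A.onTorus ∘ Θ'`**: placing the Osterwalder–Seiler adjoint of a local
observable at `v` on the torus of side `S` is the torus reflection `Θ_T` of the observable placed at
`θ₀v` and read on the site-reflected gauge field `Θ'U = GaugeConfig.negReflect U` (every side `S`;
`torusLift_negReflect`, `cfgReflect_configShift`). [cite: OsterwalderSeiler1978, §2] -/
theorem osAdjoint_onTorus (A : QCDLatticeObservable Nf R) (v : LatticeModels.Site 4)
    (U : GaugeConfig 4 S 𝔾) :
    A.osAdjoint.onTorus S v U = torusTheta (A.onTorus S (siteReflect v) U.negReflect) := by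
  unfold QCDLatticeObservable.onTorus
  rw [QCDLatticeObservable.osAdjoint_F, cfgReflect_configShift, siteReflect_neg,
    ← torusLift_negReflect]
  exact map_placeLin_fermiTheta v _

/-- The same with the observable placed at the origin (`θ₀0 = 0`). [cite: OsterwalderSeiler1978, §2] -/
theorem osAdjoint_onTorus_zero (A : QCDLatticeObservable Nf R) (U : GaugeConfig 4 S 𝔾) :
    A.osAdjoint.onTorus S 0 U = torusTheta (A.onTorus S 0 U.negReflect) := by
  rw [osAdjoint_onTorus]
  have h0 : siteReflect (0 : LatticeModels.Site 4) = 0 := by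
    funext k; simp [siteReflect_apply_ite]
  rw [h0]

/-- **`Θ_T` of the placed observable is the placed adjoint on the reflected field**:
`Θ_T (A.onTorus S v U) = (ΘA).onTorus S (θ₀v) (Θ'U)` (`Θ_T` and `Θ'` are involutions). [cite: OsterwalderSeiler1978, §2] -/
theorem torusTheta_onTorus (A : QCDLatticeObservable Nf R) (v : LatticeModels.Site 4)
    (U : GaugeConfig 4 S 𝔾) :
    torusTheta (A.onTorus S v U) = A.osAdjoint.onTorus S (siteReflect v) U.negReflect := by
  rw [osAdjoint_onTorus, siteReflect_siteReflect, WilsonSiteRP.negReflect_negReflect_config]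

end Placing

/-! ### The Berezin integral under conjugation, reversal and `Θ_T` -/

section BerezinTheta

open GrassmannAlgebra

/-- Moving one degree-one element to the right through a product of `k` degree-one elements of
an exterior algebra costs `(-1)^k`. [folklore] -/
theorem ι_mul_prod_map_ι {R M : Type*} [CommRing R] [AddCommGroup M] [Module R M]
    (m : M) (l : List M) :
    ExteriorAlgebra.ι R m * (l.map (ExteriorAlgebra.ι R)).prod =
      ((-1 : R) ^ l.length) • ((l.map (ExteriorAlgebra.ι R)).prod * ExteriorAlgebra.ι R m) := by
  induction l with
  | nil => simp
  | cons a t ih =>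
    rw [List.map_cons, List.prod_cons, ← mul_assoc, GrassmannAlgebra.ι_mul_ι_eq_neg, neg_mul,
      mul_assoc, ih, mul_smul_comm, List.length_cons, pow_succ, mul_neg_one, neg_smul, mul_assoc]

/-- **Reversal sign of a monomial**: the reversed product of `n` degree-one elements of an
exterior algebra is `(-1)^{n(n-1)/2}` times the product. [folklore] -/
theorem prod_reverse_map_ι {R M : Type*} [CommRing R] [AddCommGroup M] [Module R M]
    (l : List M) :
    ((l.map (ExteriorAlgebra.ι R)).reverse).prod =
      ((-1 : R) ^ (l.length.choose 2)) • (l.map (ExteriorAlgebra.ι R)).prod := by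
  induction l with
  | nil => simp
  | cons a t ih =>
    have hsq : ((-1 : R) ^ t.length) * (-1 : R) ^ t.length = 1 := by
      rw [← pow_add, ← two_mul, pow_mul, neg_one_sq, one_pow]
    rw [List.map_cons, List.reverse_cons, List.prod_append, List.prod_singleton, ih, List.prod_cons,
      List.length_cons, ι_mul_prod_map_ι, smul_mul_assoc, smul_smul, Nat.choose_succ_succ',
      Nat.choose_one_right, pow_add, mul_assoc, mul_comm _ ((-1 : R) ^ t.length), ← mul_assoc, hsq,
      one_mul]

variable (R : Type*) [CommRing R] {ι : Type*} [LinearOrder ι] [Fintype ι]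

/-- Reversal of a basis monomial: `rev θ_s = (-1)^{|s|(|s|-1)/2} θ_s`. [folklore] -/
theorem reverse_grassmannBasis (s : Finset ι) :
    CliffordAlgebra.reverse (grassmannBasis R ι s) =
      ((-1 : R) ^ (s.card.choose 2)) • grassmannBasis R ι s := by
  classical
  have hl : (s.sort (· ≤ ·)).map (gen R) =
      ((s.sort (· ≤ ·)).map fun i => (Pi.single i (1 : R) : ι → R)).map (ExteriorAlgebra.ι R) := by
    rw [List.map_map]; rfl
  rw [grassmannBasis_eq_prod_map_gen, hl, CliffordAlgebra.reverse_prod_map_ι, prod_reverse_map_ι,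
    List.length_map, Finset.length_sort]

/-- **The Berezin integral of a reversed element**: `∫dθ (rev a) = (-1)^{n(n-1)/2} ∫dθ a`,
`n` the number of generators (only the top monomial matters, and it reverses with that sign). [folklore] -/
theorem berezin_reverse (a : GrassmannAlgebra R ι) :
    berezin R ι (CliffordAlgebra.reverse a) =
      (-1 : R) ^ ((Fintype.card ι).choose 2) * berezin R ι a := by
  classical
  conv_lhs => rw [← (grassmannBasis R ι).sum_repr a]
  simp only [map_sum, map_smul, reverse_grassmannBasis, smul_eq_mul]
  rw [Finset.sum_eq_single Finset.univ, berezin_grassmannBasis_univ, Finset.card_univ, mul_one, mul_comm]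
  · rfl
  · intro s _ hs
    rw [berezin_grassmannBasis_of_ne R hs, mul_zero, mul_zero]
  · intro h; exact absurd (Finset.mem_univ _) h

/-- Coefficient conjugation fixes the basis monomials. [folklore] -/
theorem grassmannConj_grassmannBasis {κ : Type*} [LinearOrder κ] [Fintype κ] (s : Finset κ) :
    grassmannConj (grassmannBasis ℂ κ s) = grassmannBasis ℂ κ s := by
  classical
  rw [grassmannBasis_eq_prod_map_gen, map_list_prod, List.map_map]
  congr 1
  exact List.map_congr_left fun i _ => grassmannConj_gen i

/-- **The Berezin integral of the conjugated element is the conjugate**: `∫dθ ā = conj (∫dθ a)`. [folklore] -/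
theorem berezin_grassmannConj {κ : Type*} [LinearOrder κ] [Fintype κ] (a : GrassmannAlgebra ℂ κ) :
    berezin ℂ κ (grassmannConj a) = starRingEnd ℂ (berezin ℂ κ a) := by
  classical
  conv_lhs => rw [← (grassmannBasis ℂ κ).sum_repr a]
  simp only [map_sum, grassmannConj_smul, grassmannConj_grassmannBasis, map_smul, smul_eq_mul]
  rw [Finset.sum_eq_single Finset.univ, berezin_grassmannBasis_univ, mul_one]
  · rfl
  · intro s _ hs
    rw [berezin_grassmannBasis_of_ne ℂ hs, mul_zero]
  · intro h; exact absurd (Finset.mem_univ _) h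

variable {Nf L : ℕ} [NeZero L]

/-- The constant relating `∫dψ̄dψ ∘ Θ_T` to `conj ∘ ∫dψ̄dψ`: the reversal sign of the top monomial
times the (fermionic) Jacobian `det T` of the generator substitution. [folklore] -/
def thetaBerezinConst (Nf L : ℕ) [NeZero L] : ℂ :=
  (-1 : ℂ) ^ ((Fintype.card (FermiIdx Nf L ⊕ₗ FermiIdx Nf L)).choose 2) *
    LinearMap.det (torusThetaLin (Nf := Nf) (L := L))

/-- **The Berezin integral of a reflected element**: `∫dψ̄dψ (Θ_T a) = c · conj (∫dψ̄dψ a)` with the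
constant `c = thetaBerezinConst Nf L` (`berezin_reverse`, `berezin_map`, `berezin_grassmannConj`). [folklore] -/
theorem fermiIntegral_torusTheta (a : FermiAlg Nf L) :
    fermiIntegral (torusTheta a) = thetaBerezinConst Nf L * starRingEnd ℂ (fermiIntegral a) := by
  rw [fermiIntegral, torusTheta_apply, berezin_reverse, berezin_map, berezin_grassmannConj,
    thetaBerezinConst, mul_assoc]

end BerezinTheta

/-! ### `Θ_T` on quadratic actions: the reflected fermion matrix -/

section Quadratic

variable {Nf L : ℕ} [NeZero L]

/-- `Θ_T` commutes with rational scalars (they are real). [folklore] -/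
theorem torusTheta_ratCast_smul (r : ℚ) (a : FermiAlg Nf L) :
    torusTheta (algebraMap ℚ ℂ r • a) = algebraMap ℚ ℂ r • torusTheta a := by
  rw [LinearMap.map_smulₛₗ, eq_ratCast, map_ratCast]

/-- **`Θ_T` of an exponential is the exponential of `Θ_T`** (for nilpotent arguments; `Θ_T` is
multiplicative on the commutative subalgebra generated by one element). [folklore] -/
theorem torusTheta_grassmannExp {x : FermiAlg Nf L} (hx : IsNilpotent x) :
    torusTheta (grassmannExp x) = grassmannExp (torusTheta x) := by
  obtain ⟨k, hk⟩ := hx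
  have hk' : torusTheta x ^ k = 0 := by rw [← torusTheta_pow, hk, map_zero]
  rw [grassmannExp, grassmannExp, IsNilpotent.exp_eq_sum hk, IsNilpotent.exp_eq_sum hk', map_sum]
  refine Finset.sum_congr rfl fun i _ => ?_
  rw [← IsScalarTower.algebraMap_smul ℂ (i.factorial : ℚ)⁻¹ (x ^ i), torusTheta_ratCast_smul,
    torusTheta_pow, IsScalarTower.algebraMap_smul]

/-- The reflected index: the quark variable behind `p` with its site reflected and spin `β`. [folklore] -/
def reflIdx (p : FermiIdx Nf L) (β : Fin 4) : FermiIdx Nf L :=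
  quarkEquiv ((quarkEquiv.symm p).1,
    (Site.negReflect (quarkEquiv.symm p).2.1, (quarkEquiv.symm p).2.2.1, β))

/-- `reflIdx` on an enumerated quark variable. [folklore] -/
@[simp] theorem reflIdx_quarkEquiv (v : QuarkVar Nf L) (β : Fin 4) :
    reflIdx (quarkEquiv v) β = quarkEquiv (v.1, (Site.negReflect v.2.1, v.2.2.1, β)) := by
  simp [reflIdx]

/-- **The `Θ`-conjugate of a fermion matrix** (Montvay–Münster (4.92)/(4.95): "take the adjoint of
complex matrices", sandwich the spin blocks with `γ₀`, reflect the sites and swap the roles of the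
two indices): `(A^Θ)_{pq} = ∑_{αβ} (γ₀)_{σ_p β} conj A_{(θq)_α,(θp)_β} (γ₀)_{α σ_q}`. [cite: MontvayMunster1994, §4.2.3 (4.92) and (4.95)] -/
def thetaMatrix (A : Matrix (FermiIdx Nf L) (FermiIdx Nf L) ℂ) :
    Matrix (FermiIdx Nf L) (FermiIdx Nf L) ℂ := fun p q =>
  ∑ α : Fin 4, ∑ β : Fin 4, euclideanGamma 0 (quarkEquiv.symm p).2.2.2 β *
    star (A (reflIdx q α) (reflIdx p β)) * euclideanGamma 0 α (quarkEquiv.symm q).2.2.2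

/-- `thetaMatrix` is conjugate-linear: it commutes with negation. [folklore] -/
theorem thetaMatrix_neg (A : Matrix (FermiIdx Nf L) (FermiIdx Nf L) ℂ) :
    thetaMatrix (-A) = -thetaMatrix A := by
  ext p q
  simp only [thetaMatrix, Matrix.neg_apply, star_neg, mul_neg, neg_mul, Finset.sum_neg_distrib]

/-- `Θ_T` on `ψ_v` indexed by a quark variable. [cite: MontvayMunster1994, §4.2.3 (4.99)] -/
theorem torusTheta_psi (v : QuarkVar Nf L) :
    torusTheta (psi ℂ (quarkEquiv v)) =
      ∑ β : Fin 4, euclideanGamma 0 β v.2.2.2 •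
        psiBar ℂ (quarkEquiv (v.1, (Site.negReflect v.2.1, v.2.2.1, β))) := by
  obtain ⟨f, x, a, α⟩ := v
  exact torusTheta_q f x a α

/-- `Θ_T` on `ψ̄_v` indexed by a quark variable. [cite: MontvayMunster1994, §4.2.3 (4.99)] -/
theorem torusTheta_psiBar (v : QuarkVar Nf L) :
    torusTheta (psiBar ℂ (quarkEquiv v)) =
      ∑ β : Fin 4, euclideanGamma 0 v.2.2.2 β •
        psi ℂ (quarkEquiv (v.1, (Site.negReflect v.2.1, v.2.2.1, β))) := by
  obtain ⟨f, x, a, α⟩ := v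
  exact torusTheta_qbar f x a α

/-- The reindexing involution behind `torusTheta_quadratic`: `(v, w, δ, ε) ↦ (θw_δ, θv_ε, σ_v, σ_w)`. [folklore] -/
def thetaQuadEquiv : (QuarkVar Nf L × QuarkVar Nf L × Fin 4 × Fin 4) ≃
    (QuarkVar Nf L × QuarkVar Nf L × Fin 4 × Fin 4) where
  toFun t := ((t.2.1.1, (Site.negReflect t.2.1.2.1, t.2.1.2.2.1, t.2.2.1)),
    (t.1.1, (Site.negReflect t.1.2.1, t.1.2.2.1, t.2.2.2)), t.1.2.2.2, t.2.1.2.2.2)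
  invFun t := ((t.2.1.1, (Site.negReflect t.2.1.2.1, t.2.1.2.2.1, t.2.2.1)),
    (t.1.1, (Site.negReflect t.1.2.1, t.1.2.2.1, t.2.2.2)), t.1.2.2.2, t.2.1.2.2.2)
  left_inv t := by
    obtain ⟨⟨fv, xv, av, σv⟩, ⟨fw, xw, aw, σw⟩, δ, ε⟩ := t
    simp
  right_inv t := by
    obtain ⟨⟨fv, xv, av, σv⟩, ⟨fw, xw, aw, σw⟩, δ, ε⟩ := t
    simp

/-- **`Θ_T (ψ̄ A ψ) = ψ̄ A^Θ ψ`**: the reflection of a quadratic action is the quadratic action of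
the `Θ`-conjugate matrix (Montvay–Münster (4.92) summed over all pairs). [cite: MontvayMunster1994, §4.2.3 (4.92)] -/
theorem torusTheta_quadratic (A : Matrix (FermiIdx Nf L) (FermiIdx Nf L) ℂ) :
    torusTheta (quadratic ℂ A) = quadratic ℂ (thetaMatrix A) := by
  -- both sides as a single sum over `(v, w, δ, ε)`
  set F : QuarkVar Nf L × QuarkVar Nf L × Fin 4 × Fin 4 → FermiAlg Nf L := fun t =>
    (star (A (quarkEquiv t.1) (quarkEquiv t.2.1)) *
        (euclideanGamma 0 t.2.2.1 t.2.1.2.2.2 * euclideanGamma 0 t.1.2.2.2 t.2.2.2)) •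
      (psiBar ℂ (quarkEquiv (t.2.1.1, (Site.negReflect t.2.1.2.1, t.2.1.2.2.1, t.2.2.1))) *
        psi ℂ (quarkEquiv (t.1.1, (Site.negReflect t.1.2.1, t.1.2.2.1, t.2.2.2)))) with hF
  set G : QuarkVar Nf L × QuarkVar Nf L × Fin 4 × Fin 4 → FermiAlg Nf L := fun t =>
    (euclideanGamma 0 t.1.2.2.2 t.2.2.2 *
        star (A (reflIdx (quarkEquiv t.2.1) t.2.2.1) (reflIdx (quarkEquiv t.1) t.2.2.2)) *
          euclideanGamma 0 t.2.2.1 t.2.1.2.2.2) •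
      (psiBar ℂ (quarkEquiv t.1) * psi ℂ (quarkEquiv t.2.1)) with hG
  have hL : torusTheta (quadratic ℂ A) = ∑ t, F t := by
    rw [quadratic, map_sum, ← (quarkEquiv (Nf := Nf) (L := L)).sum_comp]
    conv_rhs => rw [Fintype.sum_prod_type]
    refine Finset.sum_congr rfl fun v _ => ?_
    rw [map_sum, ← (quarkEquiv (Nf := Nf) (L := L)).sum_comp]
    conv_rhs => rw [Fintype.sum_prod_type]
    refine Finset.sum_congr rfl fun w _ => ?_
    rw [LinearMap.map_smulₛₗ, torusTheta_mul, torusTheta_psi, torusTheta_psiBar, Finset.sum_mul,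
      Finset.smul_sum]
    conv_rhs => rw [Fintype.sum_prod_type]
    refine Finset.sum_congr rfl fun δ _ => ?_
    rw [Finset.mul_sum, Finset.smul_sum]
    refine Finset.sum_congr rfl fun ε _ => ?_
    rw [hF, smul_mul_smul_comm, smul_smul, starRingEnd_apply]
  have hR : quadratic ℂ (thetaMatrix A) = ∑ t, G t := by
    rw [quadratic, ← (quarkEquiv (Nf := Nf) (L := L)).sum_comp]
    conv_rhs => rw [Fintype.sum_prod_type]
    refine Finset.sum_congr rfl fun v _ => ?_
    rw [← (quarkEquiv (Nf := Nf) (L := L)).sum_comp]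
    conv_rhs => rw [Fintype.sum_prod_type]
    refine Finset.sum_congr rfl fun w _ => ?_
    rw [thetaMatrix, Finset.sum_smul]
    conv_rhs => rw [Fintype.sum_prod_type]
    refine Finset.sum_congr rfl fun α _ => ?_
    rw [Finset.sum_smul]
    refine Finset.sum_congr rfl fun β _ => ?_
    rw [hG, Equiv.symm_apply_apply, Equiv.symm_apply_apply]
  rw [hL, hR]
  refine Fintype.sum_equiv thetaQuadEquiv F G fun t => ?_
  obtain ⟨⟨fv, xv, av, σv⟩, ⟨fw, xw, aw, σw⟩, δ, ε⟩ := t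
  simp only [hF, hG, thetaQuadEquiv, Equiv.coe_fn_mk, reflIdx_quarkEquiv,
    WilsonSiteRP.negReflect_negReflect]
  ring_nf

end Quadratic

/-! ### Reflection symmetry of the antiperiodic Wilson–Dirac matrix (odd torus) -/

section DiracReflection

local notation "𝔾" => Matrix.specialUnitaryGroup (Fin 3) ℂ
local notation "γ" => euclideanGamma

variable {L : ℕ}

/-! #### Spin algebra: `γ₀ Nᴴ γ₀` -/

/-- The spin sandwich of the `Θ`-conjugation as a matrix product:
`∑_{αβ} (γ₀)_{σβ} conj N_{αβ} (γ₀)_{ατ} = (γ₀ Nᴴ γ₀)_{στ}`. [folklore] -/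
theorem sum_gamma_star_gamma (N : Matrix (Fin 4) (Fin 4) ℂ) (σ τ : Fin 4) :
    ∑ α, ∑ β, γ 0 σ β * star (N α β) * γ 0 α τ = (γ 0 * Nᴴ * γ 0) σ τ := by
  rw [Matrix.mul_apply]
  refine Finset.sum_congr rfl fun α _ => ?_
  rw [Matrix.mul_apply, Finset.sum_mul]
  refine Finset.sum_congr rfl fun β _ => ?_
  rw [Matrix.conjTranspose_apply]

/-- `γ₀ 1ᴴ γ₀ = 1`. [folklore] -/
theorem gamma_conj_one : γ 0 * (1 : Matrix (Fin 4) (Fin 4) ℂ)ᴴ * γ 0 = 1 := by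
  rw [Matrix.conjTranspose_one, Matrix.mul_one, euclideanGamma_mul_self]

/-- `(r·1 ∓ γ_μ)ᴴ = r·1 ∓ γ_μ` (`r` real, `γ_μ` Hermitian). [folklore] -/
theorem conjTranspose_smul_one_sub (r : ℝ) (μ : Fin 4) :
    ((r : ℂ) • (1 : Matrix (Fin 4) (Fin 4) ℂ) - γ μ)ᴴ = (r : ℂ) • 1 - γ μ := by
  rw [Matrix.conjTranspose_sub, Matrix.conjTranspose_smul, Matrix.conjTranspose_one,
    (euclideanGamma_isHermitian μ).eq, Complex.star_def, Complex.conj_ofReal]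

/-- `(r·1 + γ_μ)ᴴ = r·1 + γ_μ`. [folklore] -/
theorem conjTranspose_smul_one_add (r : ℝ) (μ : Fin 4) :
    ((r : ℂ) • (1 : Matrix (Fin 4) (Fin 4) ℂ) + γ μ)ᴴ = (r : ℂ) • 1 + γ μ := by
  rw [Matrix.conjTranspose_add, Matrix.conjTranspose_smul, Matrix.conjTranspose_one,
    (euclideanGamma_isHermitian μ).eq, Complex.star_def, Complex.conj_ofReal]

/-- `γ₀ γ_μ γ₀ = -γ_μ` for a spatial direction `μ ≠ 0`. [cite: MontvayMunster1994, App. 8.1.2 (8.6)] -/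
theorem gamma_zero_mul_gamma_mul_gamma_zero {μ : Fin 4} (hμ : μ ≠ 0) : γ 0 * γ μ * γ 0 = -γ μ := by
  rw [euclideanGamma_mul_of_ne (Ne.symm hμ), neg_mul, Matrix.mul_assoc, euclideanGamma_mul_self,
    Matrix.mul_one]

/-- `γ₀ (r·1 − γ_μ)ᴴ γ₀ = r·1 + γ_μ` for `μ ≠ 0`. [cite: MontvayMunster1994, §4.2.3 (4.92)] -/
theorem gamma_conj_sub_of_ne (r : ℝ) {μ : Fin 4} (hμ : μ ≠ 0) :
    γ 0 * ((r : ℂ) • (1 : Matrix (Fin 4) (Fin 4) ℂ) - γ μ)ᴴ * γ 0 = (r : ℂ) • 1 + γ μ := by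
  rw [conjTranspose_smul_one_sub, Matrix.mul_sub, Matrix.sub_mul, Matrix.mul_smul, Matrix.mul_one,
    Matrix.smul_mul, euclideanGamma_mul_self, gamma_zero_mul_gamma_mul_gamma_zero hμ, sub_neg_eq_add]

/-- `γ₀ (r·1 + γ_μ)ᴴ γ₀ = r·1 − γ_μ` for `μ ≠ 0`. [cite: MontvayMunster1994, §4.2.3 (4.92)] -/
theorem gamma_conj_add_of_ne (r : ℝ) {μ : Fin 4} (hμ : μ ≠ 0) :
    γ 0 * ((r : ℂ) • (1 : Matrix (Fin 4) (Fin 4) ℂ) + γ μ)ᴴ * γ 0 = (r : ℂ) • 1 - γ μ := by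
  rw [conjTranspose_smul_one_add, Matrix.mul_add, Matrix.add_mul, Matrix.mul_smul, Matrix.mul_one,
    Matrix.smul_mul, euclideanGamma_mul_self, gamma_zero_mul_gamma_mul_gamma_zero hμ, ← sub_eq_add_neg]

/-- `γ₀ (r·1 − γ₀)ᴴ γ₀ = r·1 − γ₀`. [cite: MontvayMunster1994, §4.2.3 (4.92)] -/
theorem gamma_conj_sub_zero (r : ℝ) :
    γ 0 * ((r : ℂ) • (1 : Matrix (Fin 4) (Fin 4) ℂ) - γ 0)ᴴ * γ 0 = (r : ℂ) • 1 - γ 0 := by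
  rw [conjTranspose_smul_one_sub, Matrix.mul_sub, Matrix.sub_mul, Matrix.mul_smul, Matrix.mul_one,
    Matrix.smul_mul, euclideanGamma_mul_self, Matrix.one_mul]

/-- `γ₀ (r·1 + γ₀)ᴴ γ₀ = r·1 + γ₀`. [cite: MontvayMunster1994, §4.2.3 (4.92)] -/
theorem gamma_conj_add_zero (r : ℝ) :
    γ 0 * ((r : ℂ) • (1 : Matrix (Fin 4) (Fin 4) ℂ) + γ 0)ᴴ * γ 0 = (r : ℂ) • 1 + γ 0 := by
  rw [conjTranspose_smul_one_add, Matrix.mul_add, Matrix.add_mul, Matrix.mul_smul, Matrix.mul_one,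
    Matrix.smul_mul, euclideanGamma_mul_self, Matrix.one_mul]

/-! #### Site and sign bookkeeping on the odd torus -/

/-- For a spatial direction the reflected hop condition is the hop condition:
`θx = θy + ê_μ ↔ x = y + ê_μ` (`μ ≠ 0`). [folklore] -/
theorem negReflect_eq_shift_negReflect_iff_of_ne {μ : Fin 4} (hμ : μ ≠ 0) (x y : TorusSite 4 L) :
    Site.negReflect x = Site.shift (Site.negReflect y) μ ↔ x = Site.shift y μ := by
  rw [← WilsonSiteRP.negReflect_shift_of_ne _ hμ]
  constructor
  · intro h
    have h' := congrArg Site.negReflect h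
    rwa [WilsonSiteRP.negReflect_negReflect, WilsonSiteRP.negReflect_negReflect] at h'
  · intro h; rw [h]

/-- The reflected temporal hop condition: `θx = θy + ê₀ ↔ y = x + ê₀`. [folklore] -/
theorem negReflect_eq_shift_negReflect_iff_zero (x y : TorusSite 4 L) :
    Site.negReflect x = Site.shift (Site.negReflect y) 0 ↔ y = Site.shift x 0 := by
  constructor
  · intro h
    have h1 : x = Site.negReflect (Site.shift (Site.negReflect y) 0) := by
      rw [← h, WilsonSiteRP.negReflect_negReflect]
    rw [h1, WilsonSiteRP.negReflect_shift_shift, WilsonSiteRP.negReflect_negReflect]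
  · intro h
    rw [h, WilsonSiteRP.negReflect_shift_shift]

/-- `L / 2` is the only time coordinate fixed by `t ↦ -t-1` on the odd torus: for `L = 2S+1`,
`val (-(z+1)) = S ↔ val z = S`. [folklore] -/
theorem val_neg_add_one_eq_iff [NeZero L] (hL : Odd L) (z : ZMod L) :
    (-(z + 1)).val = L / 2 ↔ z.val = L / 2 := by
  obtain ⟨S, hS⟩ := hL
  have hdiv : L / 2 = S := by omega
  have hSlt : S < L := by omega
  have hval : ∀ w : ZMod L, w.val = S ↔ w = (S : ZMod L) := fun w => by
    constructor
    · intro h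
      rw [← ZMod.natCast_zmod_val w, h]
    · intro h
      rw [h, ZMod.val_natCast, Nat.mod_eq_of_lt hSlt]
  have hzero : ((S : ZMod L) + S + 1) = 0 := by
    have : ((2 * S + 1 : ℕ) : ZMod L) = 0 := by rw [← hS, ZMod.natCast_self]
    rw [← this]; push_cast; ring
  rw [hdiv, hval, hval, neg_eq_iff_eq_neg]
  constructor
  · intro h
    linear_combination h - hzero
  · intro h
    linear_combination h + hzero

/-- **The antiperiodic layer is reflection symmetric on the odd torus**: the sign of the temporal
link based at `θ(x + ê₀)` is the sign of the temporal link based at `x`. [cite: MontvayMunster1994, §4.2.4 (4.114)] -/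
theorem apLinkSign_negReflect_shift [NeZero L] (hL : Odd L) (x : TorusSite 4 L) :
    apLinkSign L (Site.negReflect (Site.shift x 0)) 0 = apLinkSign L x 0 := by
  unfold apLinkSign
  rw [WilsonSiteRP.negReflect_apply_zero, WilsonRP.shift_apply_self]
  exact if_congr (and_congr Iff.rfl (val_neg_add_one_eq_iff hL _)) rfl rfl

/-- The sign factors are real. [folklore] -/
@[simp] theorem star_apLinkSign (x : TorusSite 4 L) (μ : Fin 4) :
    star (apLinkSign L x μ) = apLinkSign L x μ := by
  unfold apLinkSign
  split_ifs <;> simp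

/-- The site-reflected gauge field on a spatial link. [folklore] -/
theorem GaugeConfig.negReflect_apply_of_ne {G : Type*} [Group G] (U : GaugeConfig 4 L G)
    (x : TorusSite 4 L) {μ : Fin 4} (hμ : μ ≠ 0) :
    U.negReflect (x, μ) = U (Site.negReflect x, μ) := by
  simp [GaugeConfig.negReflect, hμ]

/-- The site-reflected gauge field on a temporal link. [folklore] -/
theorem GaugeConfig.negReflect_apply_zero {G : Type*} [Group G] (U : GaugeConfig 4 L G)
    (x : TorusSite 4 L) :
    U.negReflect (x, 0) = (U (Site.negReflect (Site.shift x 0), 0))⁻¹ := by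
  simp [GaugeConfig.negReflect]

/-- Entries of a special unitary matrix: `conj g_{ba} = (g⁻¹)_{ab}`. [folklore] -/
theorem star_specialUnitary_apply (A : 𝔾) (a b : Fin 3) :
    star ((A : Matrix (Fin 3) (Fin 3) ℂ) b a) = ((A⁻¹ : 𝔾) : Matrix (Fin 3) (Fin 3) ℂ) a b := by
  rw [specialUnitary_inv_apply]

/-- Entries of the inverse of a special unitary matrix: `conj (g⁻¹)_{ba} = g_{ab}`. [folklore] -/
theorem star_specialUnitary_inv_apply (A : 𝔾) (a b : Fin 3) :
    star (((A⁻¹ : 𝔾) : Matrix (Fin 3) (Fin 3) ℂ) b a) = (A : Matrix (Fin 3) (Fin 3) ℂ) a b := by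
  rw [specialUnitary_inv_apply, star_star]

/-! #### The spin blocks of the antiperiodic Wilson–Dirac matrix -/

/-- The forward hopping coefficient `b_μ(x) ρ(U(x,μ))_{ab}` on the hop `y = x + ê_μ` (else `0`). [folklore] -/
def hopF (U : GaugeConfig 4 L 𝔾) (μ : Fin 4) (x : TorusSite 4 L) (a : Fin 3) (y : TorusSite 4 L)
    (b : Fin 3) : ℂ :=
  if y = Site.shift x μ then apLinkSign L x μ * (U (x, μ) : Matrix (Fin 3) (Fin 3) ℂ) a b else 0

/-- The backward hopping coefficient `b_μ(y) ρ(U(y,μ))⁻¹_{ab}` on the hop `x = y + ê_μ` (else `0`). [folklore] -/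
def hopB (U : GaugeConfig 4 L 𝔾) (μ : Fin 4) (x : TorusSite 4 L) (a : Fin 3) (y : TorusSite 4 L)
    (b : Fin 3) : ℂ :=
  if x = Site.shift y μ then apLinkSign L y μ * (((U (y, μ))⁻¹ : 𝔾) : Matrix (Fin 3) (Fin 3) ℂ) a b
  else 0

/-- The `4 × 4` spin block of the antiperiodic Wilson–Dirac matrix between `(x, a)` and `(y, b)`. [folklore] -/
def wBlock (U : GaugeConfig 4 L 𝔾) (m r : ℝ) (x : TorusSite 4 L) (a : Fin 3) (y : TorusSite 4 L)
    (b : Fin 3) : Matrix (Fin 4) (Fin 4) ℂ :=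
  Matrix.of fun α β => wilsonDiracAP (fundamentalRep (Fin 3)) U m r (x, a, α) (y, b, β)

/-- **Normal form of the spin block**: mass times the identity minus half the sum over directions
of (forward coefficient) `(r − γ_μ)` + (backward coefficient) `(r + γ_μ)`. [cite: MontvayMunster1994, §4.2.2 (4.88)–(4.89) and §4.2.4 (4.112)] -/
theorem wBlock_eq (U : GaugeConfig 4 L 𝔾) (m r : ℝ) (x : TorusSite 4 L) (a : Fin 3)
    (y : TorusSite 4 L) (b : Fin 3) :
    wBlock U m r x a y b =
      (if x = y ∧ a = b then ((m + 4 * r : ℝ) : ℂ) else 0) • (1 : Matrix (Fin 4) (Fin 4) ℂ) -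
        (1 / 2 : ℂ) • ∑ μ : Fin 4,
          (hopF U μ x a y b • ((r : ℂ) • (1 : Matrix (Fin 4) (Fin 4) ℂ) - γ μ) +
            hopB U μ x a y b • ((r : ℂ) • (1 : Matrix (Fin 4) (Fin 4) ℂ) + γ μ)) := by
  ext α β
  simp only [wBlock, Matrix.of_apply, wilsonDiracAP, Matrix.sub_apply, Matrix.smul_apply,
    Matrix.sum_apply, Matrix.add_apply, smul_eq_mul, hopF, hopB, fundamentalRep_apply]
  congr 1
  · rw [Matrix.one_apply]
    by_cases h : x = y ∧ a = b
    · rw [if_pos h]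
      by_cases hαβ : α = β
      · rw [if_pos hαβ, mul_one, if_pos]
        rw [h.1, h.2, hαβ]
      · rw [if_neg hαβ, mul_zero, if_neg]
        intro hpq
        exact hαβ (congrArg (fun p => p.2.2) hpq)
    · rw [if_neg h, zero_mul, if_neg]
      intro hpq
      exact h ⟨congrArg Prod.fst hpq, congrArg (fun p => p.2.1) hpq⟩
  · congr 1
    refine Finset.sum_congr rfl fun μ _ => ?_
    congr 1
    · split_ifs <;> ring
    · split_ifs <;> ring

/-! #### The scalar coefficients under the reflection -/

variable (hL : Odd L)

/-- Mass coefficient: `conj` of the reflected Kronecker delta is the Kronecker delta. [folklore] -/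
theorem star_massCoeff (M : ℝ) (x y : TorusSite 4 L) (a b : Fin 3) :
    star (if Site.negReflect y = Site.negReflect x ∧ b = a then ((M : ℝ) : ℂ) else 0) =
      if x = y ∧ a = b then ((M : ℝ) : ℂ) else 0 := by
  have hiff : (Site.negReflect y = Site.negReflect x ∧ b = a) ↔ (x = y ∧ a = b) := by
    constructor
    · rintro ⟨h1, h2⟩
      refine ⟨?_, h2.symm⟩
      have h' := congrArg Site.negReflect h1
      rw [WilsonSiteRP.negReflect_negReflect, WilsonSiteRP.negReflect_negReflect] at h'
      exact h'.symm
    · rintro ⟨rfl, rfl⟩; exact ⟨rfl, rfl⟩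
  rw [apply_ite star, star_zero, Complex.star_def, Complex.conj_ofReal]
  exact if_congr hiff rfl rfl

/-- Spatial forward coefficient reflects to the backward coefficient of the reflected field. [cite: MontvayMunster1994, §4.2.3 (4.95)] -/
theorem star_hopF_of_ne (U : GaugeConfig 4 L 𝔾) {μ : Fin 4} (hμ : μ ≠ 0) (x y : TorusSite 4 L)
    (a b : Fin 3) :
    star (hopF U μ (Site.negReflect y) b (Site.negReflect x) a) = hopB U.negReflect μ x a y b := by
  unfold hopF hopB
  by_cases h : x = Site.shift y μ
  · rw [if_pos ((negReflect_eq_shift_negReflect_iff_of_ne hμ x y).2 h), if_pos h, star_mul',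
      star_apLinkSign, apLinkSign_of_ne_zero _ _ hμ, apLinkSign_of_ne_zero _ _ hμ,
      star_specialUnitary_apply, GaugeConfig.negReflect_apply_of_ne _ _ hμ]
  · rw [if_neg (fun h' => h ((negReflect_eq_shift_negReflect_iff_of_ne hμ x y).1 h')), if_neg h,
      star_zero]

/-- Spatial backward coefficient reflects to the forward coefficient of the reflected field. [cite: MontvayMunster1994, §4.2.3 (4.95)] -/
theorem star_hopB_of_ne (U : GaugeConfig 4 L 𝔾) {μ : Fin 4} (hμ : μ ≠ 0) (x y : TorusSite 4 L)
    (a b : Fin 3) :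
    star (hopB U μ (Site.negReflect y) b (Site.negReflect x) a) = hopF U.negReflect μ x a y b := by
  unfold hopF hopB
  by_cases h : y = Site.shift x μ
  · rw [if_pos ((negReflect_eq_shift_negReflect_iff_of_ne hμ y x).2 h), if_pos h, star_mul',
      star_apLinkSign, apLinkSign_of_ne_zero _ _ hμ, apLinkSign_of_ne_zero _ _ hμ,
      star_specialUnitary_inv_apply, GaugeConfig.negReflect_apply_of_ne _ _ hμ]
  · rw [if_neg (fun h' => h ((negReflect_eq_shift_negReflect_iff_of_ne hμ y x).1 h')), if_neg h,
      star_zero]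

include hL in
/-- Temporal forward coefficient reflects to the forward coefficient of the reflected field
(the temporal link is reversed AND inverted; the antiperiodic layer is reflection symmetric). [cite: MontvayMunster1994, §4.2.3 (4.95) and §4.2.4 (4.114)] -/
theorem star_hopF_zero [NeZero L] (U : GaugeConfig 4 L 𝔾) (x y : TorusSite 4 L) (a b : Fin 3) :
    star (hopF U 0 (Site.negReflect y) b (Site.negReflect x) a) = hopF U.negReflect 0 x a y b := by
  unfold hopF
  by_cases h : y = Site.shift x 0
  · rw [if_pos ((negReflect_eq_shift_negReflect_iff_zero x y).2 h), if_pos h, star_mul',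
      star_apLinkSign, star_specialUnitary_apply, GaugeConfig.negReflect_apply_zero, h,
      apLinkSign_negReflect_shift hL]
  · rw [if_neg (fun h' => h ((negReflect_eq_shift_negReflect_iff_zero x y).1 h')), if_neg h, star_zero]

include hL in
/-- Temporal backward coefficient reflects to the backward coefficient of the reflected field. [cite: MontvayMunster1994, §4.2.3 (4.95) and §4.2.4 (4.114)] -/
theorem star_hopB_zero [NeZero L] (U : GaugeConfig 4 L 𝔾) (x y : TorusSite 4 L) (a b : Fin 3) :
    star (hopB U 0 (Site.negReflect y) b (Site.negReflect x) a) = hopB U.negReflect 0 x a y b := by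
  unfold hopB
  by_cases h : x = Site.shift y 0
  · rw [if_pos ((negReflect_eq_shift_negReflect_iff_zero y x).2 h), if_pos h, star_mul',
      star_apLinkSign, star_specialUnitary_inv_apply, GaugeConfig.negReflect_apply_zero, inv_inv, h,
      apLinkSign_negReflect_shift hL]
  · rw [if_neg (fun h' => h ((negReflect_eq_shift_negReflect_iff_zero y x).1 h')), if_neg h, star_zero]

include hL in
/-- **Reflection symmetry of the antiperiodic Wilson–Dirac spin blocks** (Montvay–Münster (4.95):
`ΘS₊ = S₊†(Θψ) = S₋`, here for the whole odd torus at once):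
`γ₀ [W(U)_{(θy,b),(θx,a)}]ᴴ γ₀ = W(Θ'U)_{(x,a),(y,b)}`. [cite: MontvayMunster1994, §4.2.3 (4.95) and (4.106)] -/
theorem gamma_conj_wBlock [NeZero L] (U : GaugeConfig 4 L 𝔾) (m r : ℝ) (x y : TorusSite 4 L) (a b : Fin 3) :
    γ 0 * (wBlock U m r (Site.negReflect y) b (Site.negReflect x) a)ᴴ * γ 0 =
      wBlock U.negReflect m r x a y b := by
  rw [wBlock_eq, wBlock_eq, Matrix.conjTranspose_sub, Matrix.conjTranspose_smul,
    Matrix.conjTranspose_smul, Matrix.conjTranspose_sum, Matrix.mul_sub, Matrix.sub_mul,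
    Matrix.mul_smul, Matrix.smul_mul, Matrix.mul_smul, Matrix.smul_mul, Matrix.mul_sum,
    Matrix.sum_mul, gamma_conj_one, star_massCoeff]
  congr 2
  · rw [show star (1 / 2 : ℂ) = 1 / 2 by simp]
  · refine Finset.sum_congr rfl fun μ _ => ?_
    rw [Matrix.conjTranspose_add, Matrix.conjTranspose_smul, Matrix.conjTranspose_smul, Matrix.mul_add,
      Matrix.add_mul, Matrix.mul_smul, Matrix.smul_mul, Matrix.mul_smul, Matrix.smul_mul]
    by_cases hμ : μ = 0
    · subst hμ
      rw [gamma_conj_sub_zero, gamma_conj_add_zero, star_hopF_zero hL, star_hopB_zero hL]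
    · rw [gamma_conj_sub_of_ne r hμ, gamma_conj_add_of_ne r hμ, star_hopF_of_ne U hμ,
        star_hopB_of_ne U hμ, add_comm]

end DiracReflection

/-! ### `Θ_T` of the antiperiodic quark Boltzmann factor -/

section Boltzmann

local notation "𝔾" => Matrix.specialUnitaryGroup (Fin 3) ℂ

variable {Nf L : ℕ} [NeZero L]

/-- Entries of the flavour-diagonal antiperiodic Dirac matrix at enumerated quark variables. [folklore] -/
theorem diracMatrixAP_apply (U : GaugeConfig 4 L 𝔾) (mq : Fin Nf → ℝ) (v w : QuarkVar Nf L) :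
    diracMatrixAP U mq (quarkEquiv v) (quarkEquiv w) =
      if v.1 = w.1 then wilsonDiracAP (fundamentalRep (Fin 3)) U (mq v.1) 1 v.2 w.2 else 0 := by
  simp only [diracMatrixAP, Matrix.reindex_apply, Matrix.submatrix_apply, Equiv.symm_apply_apply,
    Matrix.of_apply]

/-- **The `Θ`-conjugate of the antiperiodic QCD Dirac matrix is the Dirac matrix of the reflected
gauge field** (odd torus): `(D^{AP}(U))^Θ = D^{AP}(Θ'U)` — reflection symmetry (4.95)/(4.106) of the
Wilson quark action with the antiperiodic layer antipodal to the reflection slice. [cite: MontvayMunster1994, §4.2.3 (4.95) and (4.106)] -/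
theorem thetaMatrix_diracMatrixAP (hL : Odd L) (U : GaugeConfig 4 L 𝔾) (mq : Fin Nf → ℝ) :
    thetaMatrix (diracMatrixAP U mq) = diracMatrixAP U.negReflect mq := by
  ext p q
  obtain ⟨⟨f, x, a, σ⟩, rfl⟩ := quarkEquiv.surjective p
  obtain ⟨⟨f', y, b, τ⟩, rfl⟩ := quarkEquiv.surjective q
  simp only [thetaMatrix, Equiv.symm_apply_apply, reflIdx_quarkEquiv, diracMatrixAP_apply]
  by_cases hf : f = f'
  · subst hf
    simp only [if_true]
    have h := congrFun (congrFun (gamma_conj_wBlock hL U (mq f) 1 x y a b) σ) τ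
    rw [← sum_gamma_star_gamma] at h
    simpa only [wBlock, Matrix.of_apply] using h
  · simp only [if_neg (Ne.symm hf), if_neg hf, star_zero, mul_zero, zero_mul, Finset.sum_const_zero]

/-- **Reflection symmetry of the antiperiodic quark Boltzmann factor on the odd torus**:
`Θ_T e^{−ψ̄ D^{AP}(U) ψ} = e^{−ψ̄ D^{AP}(Θ'U) ψ}` (Montvay–Münster (4.95)/(4.106), `ΘS₊ = S₋`,
for the whole torus action at once). [cite: MontvayMunster1994, §4.2.3 (4.95) and (4.106)] -/
theorem torusTheta_fermiBoltzmannAP (hL : Odd L) (U : GaugeConfig 4 L 𝔾) (mq : Fin Nf → ℝ) :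
    torusTheta (fermiBoltzmannAP U mq) = fermiBoltzmannAP U.negReflect mq := by
  rw [fermiBoltzmannAP, fermiBoltzmannAP, torusTheta_grassmannExp (isNilpotent_quadratic ℂ _),
    torusTheta_quadratic, thetaMatrix_neg, thetaMatrix_diracMatrixAP hL]

/-- The Boltzmann factor is even, hence central. [folklore] -/
theorem fermiBoltzmannAP_comm (U : GaugeConfig 4 L 𝔾) (mq : Fin Nf → ℝ) (a : FermiAlg Nf L) :
    a * fermiBoltzmannAP U mq = fermiBoltzmannAP U mq * a :=
  (GrassmannAlgebra.commute_of_mem_evenOdd_zero ℂ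
    (GrassmannAlgebra.grassmannExp_quadratic_mem_evenOdd_zero ℂ _) a).eq.symm

end Boltzmann

/-! ### Reality of the Osterwalder–Schrader pairing `⟨A · ΘA⟩_AP` -/

section Reality

local notation "𝔾" => Matrix.specialUnitaryGroup (Fin 3) ℂ

variable {Nf L : ℕ} [NeZero L]

/-- **`Θ_T` maps the RP integrand at `U` to the RP integrand at `Θ'U`**:
`Θ_T (A_U · (ΘA)_U · e^{−ψ̄D^{AP}(U)ψ}) = A_{Θ'U} · (ΘA)_{Θ'U} · e^{−ψ̄D^{AP}(Θ'U)ψ}` on the odd torus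
(`Θ_T` is an antimultiplicative involution exchanging `A` and `ΘA`, the Boltzmann factor is
reflection symmetric and central). [cite: MontvayMunster1994, §4.2.3 (4.95) and (4.106)] -/
theorem torusTheta_pairingIntegrand (hL : Odd L) (mq : Fin Nf → ℝ) {R : ℕ}
    (A : QCDLatticeObservable Nf R) (U : GaugeConfig 4 L 𝔾) :
    torusTheta (A.onTorus L 0 U * A.osAdjoint.onTorus L 0 U * fermiBoltzmannAP U mq) =
      A.onTorus L 0 U.negReflect * A.osAdjoint.onTorus L 0 U.negReflect *
        fermiBoltzmannAP U.negReflect mq := by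
  have h0 : siteReflect (0 : LatticeModels.Site 4) = 0 := by
    funext k; simp [siteReflect_apply_ite]
  rw [torusTheta_mul, torusTheta_mul, torusTheta_fermiBoltzmannAP hL, osAdjoint_onTorus_zero,
    torusTheta_torusTheta, torusTheta_onTorus, h0, ← fermiBoltzmannAP_comm]

/-- A complex ratio `N / D` with `N = c·conj N` and `D = c·conj D` for one constant `c` is real. [folklore] -/
theorem div_im_eq_zero_of_eq_mul_conj {N D c : ℂ} (hN : N = c * starRingEnd ℂ N)
    (hD : D = c * starRingEnd ℂ D) : (N / D).im = 0 := by
  by_cases hc : c = 0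
  · rw [hc, zero_mul] at hN
    rw [hN, zero_div, Complex.zero_im]
  by_cases hD0 : D = 0
  · rw [hD0, div_zero, Complex.zero_im]
  rw [← Complex.conj_eq_iff_im, map_div₀]
  have hN' : starRingEnd ℂ N = N / c := by
    rw [eq_div_iff hc, mul_comm]; exact hN.symm
  have hD' : starRingEnd ℂ D = D / c := by
    rw [eq_div_iff hc, mul_comm]; exact hD.symm
  rw [hN', hD', div_div_div_cancel_right₀ hc]

/-- **The Osterwalder–Schrader pairing `⟨A · ΘA⟩_AP` of Wilson lattice QCD is real** — the
`im = 0` half of `WilsonQCDSiteReflectionPositivityAP` (same binders, minus the hypotheses it does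
not need: every `β`, all masses, every `S`, every observable `A`; no positivity involved): the
numerator and the denominator of `qcdTorusExpectAP` both satisfy `N = c · conj N` with
`c = thetaBerezinConst`, by `fermiIntegral_torusTheta`, `torusTheta_pairingIntegrand` and the
`Θ'`-invariance of Wilson's measure on the odd torus (`integral_comp_negReflect_eq`), whence
`N / D = conj (N / D)`. [cite: MontvayMunster1994, §4.2.3 (4.90) and (4.95)] [cite: OsterwalderSeiler1978, §2] -/
theorem WilsonQCDSiteReflectionPositivityAP_im (Nf : ℕ) (β : ℝ) (S : ℕ) (mq : Fin Nf → ℝ) (R : ℕ)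
    (A : QCDLatticeObservable Nf R) :
    (qcdTorusExpectAP β (2 * S + 1) mq
        (fun U => A.onTorus (2 * S + 1) 0 U * A.osAdjoint.onTorus (2 * S + 1) 0 U)).im = 0 := by
  have hL : Odd (2 * S + 1) := ⟨S, rfl⟩
  have hρ := continuous_fundamentalRep (Fin 3)
  unfold qcdTorusExpectAP
  refine div_im_eq_zero_of_eq_mul_conj (c := thetaBerezinConst Nf (2 * S + 1)) ?_ ?_
  · rw [← integral_conj, ← integral_const_mul,
      ← integral_comp_negReflect_eq (fundamentalRep (Fin 3)) hρ β]
    refine integral_congr_ae (Filter.Eventually.of_forall fun U => ?_)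
    simp only
    rw [← fermiIntegral_torusTheta, torusTheta_pairingIntegrand hL mq A U]
  · rw [← integral_conj, ← integral_const_mul,
      ← integral_comp_negReflect_eq (fundamentalRep (Fin 3)) hρ β]
    refine integral_congr_ae (Filter.Eventually.of_forall fun U => ?_)
    simp only
    rw [← fermiIntegral_torusTheta, torusTheta_fermiBoltzmannAP hL]

end Reality

end Literature.MathematicalPhysics.QuantumFieldTheory

end
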